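import Summits.BirchSwinnertonDyer.BirchSwinnertonDyer.Theorems.ManinLocalTwoThreeCuspFunShiftOperators
import Summits.BirchSwinnertonDyer.BirchSwinnertonDyer.Theorems.ManinLocalTwoThreeShiftInvariantHeckeEigenvalue
import Literature.NumberTheory.EllipticCurves.HidaOrdinaryCohomologyParabolic
import HarnessLib

/-!
# The parabolic elements at a cusp and the cusp function `x ↦ u(g_x T^w g_x⁻¹)` of a homomorphism

Summit `BirchSwinnertonDyer`, route `ManinLocalTwoThree` (cell bsd-f2-manin), cruxes C2 `ManinOddAtFour`
(stmt-BirchSwinnertonDyer-22967) / C3 `ManinPrimeToThreeAtNine` (stmt-BirchSwinnertonDyer-22968).  Third file of N4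
PARABOLICITY (MEMO-es §22.2 (0), REF1 §R43 N4): basic facts about `parabolicAt g w = g T^w g⁻¹` and
`parabolicValue L K w u = (x ↦ u(g_x T^w g_x⁻¹))` (`Theorems/ManinLocalTwoThreeDefs.lean`):

* `parabolicAt g w ∈ Γ₀(L) ⟺ L ∣ w c²` (`c = g₁₀`; `parabolicAt_mem_Gamma0_iff`); `parabolicAt` depends only on the cusp
  `g∞` (`parabolicAt_eq_of_smul_infty_eq`: two matrices with the same cusp differ by `±T^k`, which commutes with `T^w`);
  conjugation `parabolicAt (γ g) w = γ (parabolicAt g w) γ⁻¹`; powers `(parabolicAt g w)^n = parabolicAt g (w n)`;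
  every element of `SL₂(ℤ)` fixing a cusp is `± parabolicAt g w` (`exists_eq_parabolicAt_of_smul_eq`);
* degree-`0` cocycles (`HidaCohomology.cocycles 0 L K` = homomorphisms `Γ₀(L) → K`) are additive, conjugation
  invariant, and `u(γⁿ) = n u(γ)`;
* hence `parabolicValue L K w u ∈ cuspInvariants L K` for `u` a cocycle (`parabolicValue_mem_cuspInvariants`), it can be
  evaluated with ANY matrix of the cusp (`parabolicValue_eq_of_smul_infty`), and membership `parabolicAt g_x w ∈ Γ₀(L)` is
  constant on `Γ₀(L)`-orbits (`parabolicAt_cuspMatrix_mem_iff_of_sameOrbit`).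

No new definitions; nothing about BSD or Manin's conjecture is proved here.

References: G. Shimura (1971) §1.3–1.5 (parabolic elements), §8.1 ((8.1.4) parabolic cocycles); cell memo HOME/MEMO-es.md
§22.2.
-/

set_option autoImplicit false
set_option linter.dupNamespace false

open scoped MatrixGroups

open CongruenceSubgroup Matrix.SpecialLinearGroup Literature.NumberTheory.EllipticCurves.ModularForms
  Literature.NumberTheory.EllipticCurves.ModularForms.HidaCohomology

namespace Summit.BirchSwinnertonDyer.BirchSwinnertonDyer.Theorems.ManinLocalTwoThree

/-! ### `parabolicAt` -/

section ParabolicAt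

/-- Lower-left entry of `g T^w g⁻¹`: `−w c²`. [cite: Shimura1971, §1.3] -/
theorem parabolicAt_apply_one_zero (g : SL(2, ℤ)) (w : ℤ) : (parabolicAt g w) 1 0 = -w * g 1 0 ^ 2 := by
  rw [parabolicAt_def]
  exact conj_T_zpow_apply_10 g w

/-- **`g T^w g⁻¹ ∈ Γ₀(L) ⟺ L ∣ w c²`.** [cite: Shimura1971, §1.3] -/
theorem parabolicAt_mem_Gamma0_iff (L : ℕ) (g : SL(2, ℤ)) (w : ℤ) :
    parabolicAt g w ∈ Gamma0 L ↔ (L : ℤ) ∣ w * g 1 0 ^ 2 := by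
  rw [Gamma0_mem, parabolicAt_apply_one_zero, ZMod.intCast_zmod_eq_zero_iff_dvd, neg_mul, dvd_neg]

/-- Conjugation: `parabolicAt (γ g) w = γ · parabolicAt g w · γ⁻¹`. [cite: Shimura1971, §1.3] -/
theorem parabolicAt_mul_left (γ g : SL(2, ℤ)) (w : ℤ) : parabolicAt (γ * g) w = γ * parabolicAt g w * γ⁻¹ := by
  rw [parabolicAt_def, parabolicAt_def, mul_inv_rev]
  group

/-- Powers: `(parabolicAt g w)ⁿ = parabolicAt g (w n)`. [cite: Shimura1971, §1.3] -/
theorem parabolicAt_pow (g : SL(2, ℤ)) (w : ℤ) (n : ℕ) : parabolicAt g w ^ n = parabolicAt g (w * n) := by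
  rw [parabolicAt_def, parabolicAt_def, conj_pow, ← zpow_natCast, ← zpow_mul]

/-- An element of `SL₂(ℤ)` fixing `∞` commutes with `T^w` (it is `± T^k`). [cite: Shimura1971, §1.3] -/
theorem mul_T_zpow_eq_of_apply_one_zero (δ : SL(2, ℤ)) (h : δ 1 0 = 0) (w : ℤ) :
    δ * ModularGroup.T ^ w = ModularGroup.T ^ w * δ := by
  obtain ⟨hdiag, -⟩ := sl_diag_of_apply_one_zero δ h
  ext i j
  rw [Matrix.SpecialLinearGroup.coe_mul, Matrix.SpecialLinearGroup.coe_mul, ModularGroup.coe_T_zpow]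
  fin_cases i <;> fin_cases j <;> simp [Matrix.mul_apply, Fin.sum_univ_two, h, hdiag, mul_comm, add_comm]

/-- **`parabolicAt g w` depends only on the cusp `g∞`.** [cite: Shimura1971, §1.3] -/
theorem parabolicAt_eq_of_smul_infty_eq (g g' : SL(2, ℤ)) (w : ℤ)
    (h : (mapGL ℚ g : GL (Fin 2) ℚ) • (OnePoint.infty : OnePoint ℚ) = (mapGL ℚ g' : GL (Fin 2) ℚ) • OnePoint.infty) :
    parabolicAt g w = parabolicAt g' w := by
  set δ : SL(2, ℤ) := g⁻¹ * g' with hδ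
  have hfix : (mapGL ℚ δ : GL (Fin 2) ℚ) • (OnePoint.infty : OnePoint ℚ) = OnePoint.infty := by
    rw [hδ, map_mul, mul_smul, ← h, ← mul_smul, ← map_mul, inv_mul_cancel, map_one, one_smul]
  have h10 : δ 1 0 = 0 := (mapGL_smul_infty_eq_self_iff δ).mp hfix
  have hg' : g' = g * δ := by rw [hδ, mul_inv_cancel_left]
  rw [hg', parabolicAt_def, parabolicAt_def, mul_inv_rev, mul_assoc g δ, mul_assoc g,
    mul_T_zpow_eq_of_apply_one_zero δ h10 w, mul_assoc, mul_assoc, mul_inv_cancel_left]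

/-- **Every element of `SL₂(ℤ)` fixing the cusp `g∞` is `± parabolicAt g w`.** [cite: Shimura1971, §1.3] -/
theorem exists_eq_parabolicAt_of_smul_eq (g γ : SL(2, ℤ))
    (h : (mapGL ℚ γ : GL (Fin 2) ℚ) • (mapGL ℚ g : GL (Fin 2) ℚ) • (OnePoint.infty : OnePoint ℚ)
      = (mapGL ℚ g : GL (Fin 2) ℚ) • OnePoint.infty) :
    ∃ w : ℤ, γ = parabolicAt g w ∨ γ = -parabolicAt g w := by
  set δ : SL(2, ℤ) := g⁻¹ * (γ * g) with hδ
  have hfix : (mapGL ℚ δ : GL (Fin 2) ℚ) • (OnePoint.infty : OnePoint ℚ) = OnePoint.infty := by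
    rw [hδ, map_mul, map_mul, mul_smul, mul_smul, h, ← mul_smul, ← map_mul, inv_mul_cancel, map_one, one_smul]
  have h10 : δ 1 0 = 0 := (mapGL_smul_infty_eq_self_iff δ).mp hfix
  obtain ⟨hdiag, hunit⟩ := sl_diag_of_apply_one_zero δ h10
  have hγ : γ = g * δ * g⁻¹ := by rw [hδ]; group
  rcases Int.eq_one_or_neg_one_of_mul_eq_one' hunit with ⟨h0, h1⟩ | ⟨h0, h1⟩
  · refine ⟨δ 0 1, Or.inl ?_⟩
    rw [hγ, parabolicAt_def]
    congr 2
    ext i j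
    rw [ModularGroup.coe_T_zpow]
    fin_cases i <;> fin_cases j <;> simp [h0, h1, h10]
  · set b : ℤ := δ 0 1 with hb
    refine ⟨-b, Or.inr ?_⟩
    rw [hγ, parabolicAt_def]
    have hT : δ = -(ModularGroup.T ^ (-b)) := by
      ext i j
      rw [Matrix.SpecialLinearGroup.coe_neg, ModularGroup.coe_T_zpow]
      fin_cases i <;> fin_cases j <;> simp [h0, h1, h10, ← hb]
    rw [hT, mul_neg, neg_mul]

end ParabolicAt

/-! ### Degree-`0` cocycles are homomorphisms -/

section Cocycles

variable {L : ℕ} {K : Type*} [CommRing K] {u : Gamma0 L → Fin 1 → K}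

-- `cocycle_zero_mul`, `cocycle_zero_inv` (additivity, inverses): `Theorems/ManinLocalTwoThreeShiftInvariantHeckeEigenvalue.lean`.

/-- Conjugation invariance: `u(γ δ γ⁻¹) = u(δ)`. [cite: Shimura1971, §8.1 (8.1.1)] -/
theorem cocycle_zero_conj (hu : u ∈ cocycles 0 L K) (γ δ : Gamma0 L) : u (γ * δ * γ⁻¹) = u δ := by
  rw [cocycle_zero_mul hu, cocycle_zero_mul hu, cocycle_zero_inv hu]
  abel

/-- Powers: `u(γⁿ) = n • u(γ)`. [cite: Shimura1971, §8.1 (8.1.1)] -/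
theorem cocycle_zero_pow (hu : u ∈ cocycles 0 L K) (γ : Gamma0 L) (n : ℕ) : u (γ ^ n) = n • u γ := by
  induction n with
  | zero => rw [pow_zero, cocycle_map_one hu, zero_smul]
  | succ n ih => rw [pow_succ, cocycle_zero_mul hu, ih, succ_nsmul]

omit [CommRing K] in
/-- Values at equal elements with different membership proofs (plumbing). [folklore] -/
theorem cocycle_congr (u : Gamma0 L → Fin 1 → K) {a b : SL(2, ℤ)} (hab : a = b) (ha : a ∈ Gamma0 L) (hb : b ∈ Gamma0 L) :
    u ⟨a, ha⟩ = u ⟨b, hb⟩ := by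
  subst hab
  rfl

end Cocycles

/-! ### The cusp function `parabolicValue` -/

section Value

variable (L : ℕ) {K : Type*} [CommRing K] (w : ℤ)

/-- **Evaluation with any matrix of the cusp**: if `g∞ = x` and `g T^w g⁻¹ ∈ Γ₀(L)` then
`parabolicValue L K w u x = u(g T^w g⁻¹)`. [cite: Shimura1971, §8.1 (8.1.4)] -/
theorem parabolicValue_eq_of_smul_infty (u : Gamma0 L → Fin 1 → K) (g : SL(2, ℤ)) (x : OnePoint ℚ)
    (hx : (mapGL ℚ g : GL (Fin 2) ℚ) • (OnePoint.infty : OnePoint ℚ) = x) (h : parabolicAt g w ∈ Gamma0 L) :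
    parabolicValue L K w u x = u ⟨parabolicAt g w, h⟩ 0 := by
  have he : parabolicAt (cuspMatrix x) w = parabolicAt g w :=
    parabolicAt_eq_of_smul_infty_eq _ _ w (by rw [cuspMatrix_smul_infty, hx])
  have h' : parabolicAt (cuspMatrix x) w ∈ Gamma0 L := he ▸ h
  rw [parabolicValue_apply_of_mem L K w u x h', cocycle_congr u he h' h]

/-- Membership with any matrix of the cusp. [cite: Shimura1971, §1.3] -/
theorem parabolicAt_cuspMatrix_mem_iff (g : SL(2, ℤ)) (x : OnePoint ℚ)
    (hx : (mapGL ℚ g : GL (Fin 2) ℚ) • (OnePoint.infty : OnePoint ℚ) = x) :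
    parabolicAt (cuspMatrix x) w ∈ Gamma0 L ↔ parabolicAt g w ∈ Gamma0 L := by
  rw [parabolicAt_eq_of_smul_infty_eq (cuspMatrix x) g w (by rw [cuspMatrix_smul_infty, hx])]

/-- If `g∞ = x` and `g T^w g⁻¹ ∉ Γ₀(L)` then `parabolicValue L K w u x = 0`. [cite: Shimura1971, §8.1 (8.1.4)] -/
theorem parabolicValue_eq_zero_of_smul_infty (u : Gamma0 L → Fin 1 → K) (g : SL(2, ℤ)) (x : OnePoint ℚ)
    (hx : (mapGL ℚ g : GL (Fin 2) ℚ) • (OnePoint.infty : OnePoint ℚ) = x) (h : parabolicAt g w ∉ Gamma0 L) :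
    parabolicValue L K w u x = 0 :=
  parabolicValue_apply_of_not_mem L K w u x (fun h' ↦ h ((parabolicAt_cuspMatrix_mem_iff L w g x hx).mp h'))

/-- **Membership is constant on `Γ₀(L)`-orbits**: for `γ ∈ Γ₀(L)`, `g_{γx} T^w g_{γx}⁻¹ = γ' (g_x T^w g_x⁻¹) γ'⁻¹`.
[cite: Shimura1971, §1.3] -/
theorem parabolicAt_cuspMatrix_mem_iff_of_smul (γ : Gamma0 L) (x : OnePoint ℚ) :
    parabolicAt (cuspMatrix ((mapGL ℚ (γ : SL(2, ℤ)) : GL (Fin 2) ℚ) • x)) w ∈ Gamma0 L ↔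
      parabolicAt (cuspMatrix x) w ∈ Gamma0 L := by
  have hg : (mapGL ℚ ((γ : SL(2, ℤ)) * cuspMatrix x) : GL (Fin 2) ℚ) • (OnePoint.infty : OnePoint ℚ) =
      (mapGL ℚ (γ : SL(2, ℤ)) : GL (Fin 2) ℚ) • x := by
    rw [map_mul, mul_smul, cuspMatrix_smul_infty]
  rw [parabolicAt_cuspMatrix_mem_iff L w _ _ hg, parabolicAt_mul_left]
  constructor
  · intro h
    have h' := Subgroup.mul_mem _ (Subgroup.mul_mem _ (Subgroup.inv_mem _ γ.2) h) γ.2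
    simpa only [mul_assoc, inv_mul_cancel_left, mul_inv_cancel, mul_one, inv_mul_cancel] using h'
  · intro h
    exact Subgroup.mul_mem _ (Subgroup.mul_mem _ γ.2 h) (Subgroup.inv_mem _ γ.2)

/-- **`parabolicValue L K w u` is `Γ₀(L)`-invariant** for a degree-`0` cocycle `u` (conjugation invariance of homomorphisms).
[cite: Shimura1971, §8.1 (8.1.4)] -/
theorem parabolicValue_mem_cuspInvariants {u : Gamma0 L → Fin 1 → K} (hu : u ∈ cocycles 0 L K) :
    parabolicValue L K w u ∈ cuspInvariants L K := by
  rw [mem_cuspInvariants]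
  intro γ x
  by_cases h : parabolicAt (cuspMatrix x) w ∈ Gamma0 L
  · have hg : (mapGL ℚ ((γ : SL(2, ℤ)) * cuspMatrix x) : GL (Fin 2) ℚ) • (OnePoint.infty : OnePoint ℚ) =
        (mapGL ℚ (γ : SL(2, ℤ)) : GL (Fin 2) ℚ) • x := by
      rw [map_mul, mul_smul, cuspMatrix_smul_infty]
    have hmem : parabolicAt ((γ : SL(2, ℤ)) * cuspMatrix x) w ∈ Gamma0 L := by
      rw [parabolicAt_mul_left]
      exact Subgroup.mul_mem _ (Subgroup.mul_mem _ γ.2 h) (Subgroup.inv_mem _ γ.2)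
    rw [parabolicValue_eq_of_smul_infty L w u _ _ hg hmem, parabolicValue_apply_of_mem L K w u x h]
    have he : (⟨parabolicAt ((γ : SL(2, ℤ)) * cuspMatrix x) w, hmem⟩ : Gamma0 L) =
        γ * ⟨parabolicAt (cuspMatrix x) w, h⟩ * γ⁻¹ := by
      apply Subtype.ext
      simp only [parabolicAt_mul_left, Subgroup.coe_mul, Subgroup.coe_inv]
    rw [he, cocycle_zero_conj hu]
  · rw [parabolicValue_apply_of_not_mem L K w u x h, parabolicValue_apply_of_not_mem L K w u _
      (fun h' ↦ h ((parabolicAt_cuspMatrix_mem_iff_of_smul L w γ x).mp h'))]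

/-- Membership is constant on orbits (orbit form). [cite: Shimura1971, §1.3] -/
theorem parabolicAt_cuspMatrix_mem_iff_of_sameOrbit {x y : OnePoint ℚ}
    (hxy : ∃ γ : Gamma0 L, (mapGL ℚ (γ : SL(2, ℤ)) : GL (Fin 2) ℚ) • x = y) :
    parabolicAt (cuspMatrix x) w ∈ Gamma0 L ↔ parabolicAt (cuspMatrix y) w ∈ Gamma0 L := by
  obtain ⟨γ, rfl⟩ := hxy
  exact (parabolicAt_cuspMatrix_mem_iff_of_smul L w γ x).symm

end Value

end Summit.BirchSwinnertonDyer.BirchSwinnertonDyer.Theorems.ManinLocalTwoThree
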